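import Literature.MathematicalPhysics.QuantumFieldTheory.OSTimeTubeCoordinates
import Literature.Analysis.Complex.SeveralVariables
import HarnessLib

/-!
# Time derivatives and spatial smearings of a time-holomorphic function on the time tube

Support file (everything proved; no definitions, no named facts) for (B)
`Literature.MathematicalPhysics.QuantumFieldTheory.OS1973_lorentzInvariant_of_timeContinuation`
(`OSTimeContinuation`; Osterwalder–Schrader I (1973), §4.2). In the coordinates of
`OSTimeTubeCoordinates` a function `𝔚` continuous on the time tube and holomorphic in the times
is a jointly continuous function `(w, y) ↦ 𝔚 (tsCfg w y)` on `𝒯ₙ × (ℝ^d)ⁿ`, holomorphic in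
`w ∈ 𝒯ₙ`. This file records the two analytic operations on such functions which the
infinitesimal form of Osterwalder–Schrader's argument ((4.14)–(4.17): the generators `Y_{0j}` of
Euclidean rotations and `X_{0j}` of boosts) uses:

* **time derivatives** `∂_v 𝔚 (w, y) = fderiv ℂ (𝔚 (tsCfg · y)) w v`: they are again jointly
  continuous on `𝒯ₙ × (ℝ^d)ⁿ` (`continuousOn_fderiv_tsCfg`; Cauchy's estimate for the difference
  `𝔚(·, y) − 𝔚(·, y₀)` and uniform continuity on compact sets, plus the continuity of the
  derivative of a holomorphic function of several variables,
  `Literature.Analysis.Complex.SCV.continuousOn_fderiv`), holomorphic in `w`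
  (`Literature.Analysis.Complex.SCV.differentiableOn_fderiv_apply`), and they are the derivatives
  along real time shifts (`hasDerivAt_apply_tsCfg_add_ofReal_smul`);
* **spatial smearings** `K_ψ(w) = ∫ 𝔚 (tsCfg w y) ψ(y) dy` against continuous compactly
  supported `ψ`: holomorphic on `𝒯ₙ` with `∂_v K_ψ (w) = ∫ ∂_v 𝔚 (w, y) ψ(y) dy`
  (`hasFDerivAt_integral_tsCfg_mul`, `fderiv_integral_tsCfg_mul`; holomorphic dependence of
  dominated parameter integrals,
  `Literature.Analysis.Complex.hasFDerivAt_integral_of_dominated_of_differentiableOn`, the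
  majorant being `sup |𝔚| · |ψ|` over a compact piece of the time tube).

## References

* K. Osterwalder, R. Schrader, *Axioms for Euclidean Green's functions*, Comm. Math. Phys. 31
  (1973) 83–112, §4.2. [OsterwalderSchraderCMP1973]
* K. Osterwalder, R. Schrader, *Axioms for Euclidean Green's functions II*, Comm. Math. Phys. 42
  (1975) 281–305, §IV.2 Thm. 4.3. [OsterwalderSchraderCMP1975]
-/

noncomputable section

open Filter Complex Set MeasureTheory Metric
open scoped Topology
open Literature.MathematicalPhysics.QuantumLattice

namespace Literature.MathematicalPhysics.QuantumFieldTheory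

variable {d n : ℕ} {𝔚 : (Fin n → Fin (d + 1) → ℂ) → ℂ}

/-! ### Time derivatives -/

/-- **The derivative of a holomorphic slice along a real time shift**: for `w ∈ 𝒯ₙ`,
`d/ds 𝔚 (tsCfg (w + s v) y) = ∂_v 𝔚 (w + s v, y)` wherever `w + s v ∈ 𝒯ₙ`. [folklore] -/
theorem hasDerivAt_apply_tsCfg_add_ofReal_smul (hh : IsTimeHolomorphicOn 𝔚 (timeTube d n))
    (y : Fin n → EuclideanSpace ℝ (Fin d)) {w v : Fin n → ℂ} {s : ℝ}
    (hws : w + (s : ℂ) • v ∈ cTimeTube n) :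
    HasDerivAt (fun s : ℝ => 𝔚 (tsCfg (w + (s : ℂ) • v) y))
      (fderiv ℂ (fun w => 𝔚 (tsCfg w y)) (w + (s : ℂ) • v) v) s := by
  have hd : DifferentiableAt ℂ (fun w => 𝔚 (tsCfg w y)) (w + (s : ℂ) • v) :=
    (hh.differentiableOn_tsCfg y).differentiableAt (isOpen_cTimeTube.mem_nhds hws)
  exact (Literature.Analysis.Complex.SCV.hasDerivAt_slice hd).comp_ofReal

/-- A uniform-continuity bound for a continuous function of `(w, y)` on a compact product:
the slices `𝔚(·, y)` converge to `𝔚(·, y₀)` uniformly on the compact `w`-set as `y → y₀`. [folklore] -/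
theorem exists_forall_norm_sub_lt_of_continuousOn_prod {X Y E : Type*} [PseudoMetricSpace X]
    [PseudoMetricSpace Y] [SeminormedAddCommGroup E] {f : X × Y → E} {K : Set X} {L : Set Y}
    (hK : IsCompact K) (hL : IsCompact L) (hf : ContinuousOn f (K ×ˢ L)) {y₀ : Y} (hy₀ : y₀ ∈ L)
    {ε : ℝ} (hε : 0 < ε) :
    ∃ δ > 0, ∀ x ∈ K, ∀ y ∈ L, dist y y₀ < δ → ‖f (x, y) - f (x, y₀)‖ < ε := by
  have huc := (hK.prod hL).uniformContinuousOn_of_continuous hf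
  rw [Metric.uniformContinuousOn_iff] at huc
  obtain ⟨δ, hδ, h⟩ := huc ε hε
  refine ⟨δ, hδ, fun x hx y hy hdist => ?_⟩
  have h1 := h (x, y) ⟨hx, hy⟩ (x, y₀) ⟨hx, hy₀⟩ (by
    rw [Prod.dist_eq, dist_self]
    exact max_lt (by simpa using hδ) hdist)
  rwa [dist_eq_norm] at h1

/-- **Time derivatives of a continuous time-holomorphic function are jointly continuous** on
`𝒯ₙ × (ℝ^d)ⁿ`: `(w, y) ↦ ∂_v 𝔚 (w, y) = fderiv ℂ (𝔚 (tsCfg · y)) w v`. Proof: in `w` at fixed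
`y₀` this is the continuity of the derivative of a holomorphic function of several variables; the
variation in `y` is controlled by Cauchy's estimate for the holomorphic difference
`𝔚(·, y) − 𝔚(·, y₀)`, which is uniformly small on a ball by uniform continuity of `𝔚` on a compact
piece of the time tube. [folklore] -/
theorem continuousOn_fderiv_tsCfg (hc : ContinuousOn 𝔚 (timeTube d n))
    (hh : IsTimeHolomorphicOn 𝔚 (timeTube d n)) (v : Fin n → ℂ) :
    ContinuousOn (fun p : (Fin n → ℂ) × (Fin n → EuclideanSpace ℝ (Fin d)) =>
      fderiv ℂ (fun w => 𝔚 (tsCfg w p.2)) p.1 v) (cTimeTube n ×ˢ univ) := by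
  rintro ⟨w₀, y₀⟩ ⟨hw₀, -⟩
  set W : (Fin n → EuclideanSpace ℝ (Fin d)) → (Fin n → ℂ) → ℂ := fun y w => 𝔚 (tsCfg w y)
    with hW
  have hWd : ∀ y, DifferentiableOn ℂ (W y) (cTimeTube n) := fun y => hh.differentiableOn_tsCfg y
  obtain ⟨δ, hδ, hball⟩ := Metric.isOpen_iff.1 isOpen_cTimeTube w₀ hw₀
  -- uniform continuity on a compact piece of the time tube
  set K : Set (Fin n → ℂ) := closedBall w₀ (δ / 2) with hK_def
  set L : Set (Fin n → EuclideanSpace ℝ (Fin d)) := closedBall y₀ 1 with hL_def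
  have hK : IsCompact K := isCompact_closedBall _ _
  have hL : IsCompact L := isCompact_closedBall _ _
  have hKsub : K ⊆ cTimeTube n := fun w hw =>
    hball (closedBall_subset_ball (by linarith) hw)
  have hcW : ContinuousOn (fun p : (Fin n → ℂ) × (Fin n → EuclideanSpace ℝ (Fin d)) =>
      𝔚 (tsCfg p.1 p.2)) (K ×ˢ L) := hc.tsCfg.mono (prod_mono hKsub (subset_univ _))
  rw [Metric.continuousWithinAt_iff]
  intro ε hε
  -- (ii) continuity of the derivative in `w` at fixed `y₀`
  have hcont := Literature.Analysis.Complex.SCV.continuousOn_fderiv (hWd y₀) isOpen_cTimeTube w₀ hw₀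
  rw [Metric.continuousWithinAt_iff] at hcont
  obtain ⟨δ₁, hδ₁, hδ₁'⟩ := hcont (ε / (2 * (‖v‖ + 1))) (by positivity)
  -- (i) uniform smallness of `𝔚(·, y) - 𝔚(·, y₀)` on `K`
  set ε₂ : ℝ := ε * δ / (16 * (‖v‖ + 1)) with hε₂
  have hε₂pos : 0 < ε₂ := by positivity
  obtain ⟨δ₂, hδ₂, hδ₂'⟩ := exists_forall_norm_sub_lt_of_continuousOn_prod hK hL hcW
    (mem_closedBall_self zero_le_one) hε₂pos
  refine ⟨min (δ / 4) (min δ₁ (min 1 δ₂)), by positivity, ?_⟩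
  rintro ⟨w, y⟩ ⟨hw, -⟩ hdist
  rw [Prod.dist_eq, max_lt_iff] at hdist
  obtain ⟨hdw, hdy⟩ := hdist
  have hdw4 : dist w w₀ < δ / 4 := hdw.trans_le (min_le_left _ _)
  have hdw1 : dist w w₀ < δ₁ := hdw.trans_le ((min_le_right _ _).trans (min_le_left _ _))
  have hdy1 : dist y y₀ < 1 :=
    hdy.trans_le ((min_le_right _ _).trans ((min_le_right _ _).trans (min_le_left _ _)))
  have hdy2 : dist y y₀ < δ₂ :=
    hdy.trans_le ((min_le_right _ _).trans ((min_le_right _ _).trans (min_le_right _ _)))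
  have hyL : y ∈ L := mem_closedBall.2 hdy1.le
  have hwT : w ∈ cTimeTube n := hball (mem_ball.2 (by linarith))
  -- Cauchy estimate for the difference on `ball w (δ/4) ⊆ K`
  have hballK : ball w (δ / 4) ⊆ K := fun w' hw' => by
    rw [hK_def, mem_closedBall]
    have := dist_triangle w' w w₀
    rw [mem_ball] at hw'
    linarith
  have hdiffD : DifferentiableOn ℂ (fun w' => W y w' - W y₀ w') (ball w (δ / 4)) :=
    ((hWd y).mono (hballK.trans hKsub)).sub ((hWd y₀).mono (hballK.trans hKsub))
  have hMD : ∀ w' ∈ ball w (δ / 4), ‖W y w' - W y₀ w'‖ ≤ ε₂ := fun w' hw' =>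
    (hδ₂' w' (hballK hw') y hyL hdy2).le
  have hC := Literature.Analysis.Complex.norm_fderiv_le_of_forall_mem_ball_norm_le
    (by positivity : (0 : ℝ) < δ / 4) hdiffD hMD
  have hwy : DifferentiableAt ℂ (W y) w :=
    (hWd y).differentiableAt (isOpen_cTimeTube.mem_nhds hwT)
  have hwy₀ : DifferentiableAt ℂ (W y₀) w :=
    (hWd y₀).differentiableAt (isOpen_cTimeTube.mem_nhds hwT)
  have hsub : fderiv ℂ (fun w' => W y w' - W y₀ w') w = fderiv ℂ (W y) w - fderiv ℂ (W y₀) w :=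
    fderiv_sub hwy hwy₀
  -- term 1
  have h1 : ‖fderiv ℂ (W y) w v - fderiv ℂ (W y₀) w v‖ ≤ ε / 2 := by
    have hv1 : ‖v‖ ≤ ‖v‖ + 1 := by linarith
    calc ‖fderiv ℂ (W y) w v - fderiv ℂ (W y₀) w v‖
        = ‖(fderiv ℂ (fun w' => W y w' - W y₀ w') w) v‖ := by
          rw [hsub, sub_apply]
      _ ≤ ‖fderiv ℂ (fun w' => W y w' - W y₀ w') w‖ * ‖v‖ := ContinuousLinearMap.le_opNorm _ _
      _ ≤ 2 * ε₂ / (δ / 4) * ‖v‖ := by gcongr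
      _ = ε / 2 * (‖v‖ / (‖v‖ + 1)) := by rw [hε₂]; field_simp; ring
      _ ≤ ε / 2 * 1 := by
          gcongr
          rw [div_le_one (by positivity)]
          exact hv1
      _ = ε / 2 := mul_one _
  -- term 2
  have h2 : ‖fderiv ℂ (W y₀) w v - fderiv ℂ (W y₀) w₀ v‖ < ε / 2 := by
    have h := hδ₁' hwT hdw1
    rw [dist_eq_norm] at h
    have hv : ‖v‖ < ‖v‖ + 1 := lt_add_one _
    calc ‖fderiv ℂ (W y₀) w v - fderiv ℂ (W y₀) w₀ v‖
        = ‖(fderiv ℂ (W y₀) w - fderiv ℂ (W y₀) w₀) v‖ := by rw [sub_apply]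
      _ ≤ ‖fderiv ℂ (W y₀) w - fderiv ℂ (W y₀) w₀‖ * ‖v‖ := ContinuousLinearMap.le_opNorm _ _
      _ ≤ ε / (2 * (‖v‖ + 1)) * ‖v‖ := by gcongr
      _ < ε / (2 * (‖v‖ + 1)) * (‖v‖ + 1) := by gcongr
      _ = ε / 2 := by field_simp
  calc dist (fderiv ℂ (W y) w v) (fderiv ℂ (W y₀) w₀ v)
      ≤ ‖fderiv ℂ (W y) w v - fderiv ℂ (W y₀) w v‖ + ‖fderiv ℂ (W y₀) w v - fderiv ℂ (W y₀) w₀ v‖ := by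
        rw [dist_eq_norm]; exact norm_sub_le_norm_sub_add_norm_sub _ _ _
    _ < ε / 2 + ε / 2 := add_lt_add_of_le_of_lt h1 h2
    _ = ε := add_halves ε

/-- Time derivatives are again holomorphic in the times. [folklore] -/
theorem differentiableOn_fderiv_tsCfg (hh : IsTimeHolomorphicOn 𝔚 (timeTube d n))
    (y : Fin n → EuclideanSpace ℝ (Fin d)) (v : Fin n → ℂ) :
    DifferentiableOn ℂ (fun w => fderiv ℂ (fun w => 𝔚 (tsCfg w y)) w v) (cTimeTube n) :=
  Literature.Analysis.Complex.SCV.differentiableOn_fderiv_apply (hh.differentiableOn_tsCfg y)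
    isOpen_cTimeTube v

/-- At fixed times in `𝒯ₙ`, time derivatives are continuous in space. [folklore] -/
theorem continuous_fderiv_tsCfg_right (hc : ContinuousOn 𝔚 (timeTube d n))
    (hh : IsTimeHolomorphicOn 𝔚 (timeTube d n)) (v : Fin n → ℂ) {w : Fin n → ℂ}
    (hw : w ∈ cTimeTube n) :
    Continuous fun y : Fin n → EuclideanSpace ℝ (Fin d) => fderiv ℂ (fun w => 𝔚 (tsCfg w y)) w v :=
  (continuousOn_fderiv_tsCfg hc hh v).comp_continuous (continuous_const.prodMk continuous_id)
    fun _ => ⟨hw, mem_univ _⟩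

/-! ### Spatial smearings -/

/-- A continuous function on the time tube is bounded on `closedBall w₀ δ × tsupport ψ` for a
closed ball of times inside `𝒯ₙ` and a compactly supported `ψ`. [folklore] -/
theorem exists_bound_tsCfg_closedBall (hc : ContinuousOn 𝔚 (timeTube d n)) {w₀ : Fin n → ℂ}
    {δ : ℝ} (hsub : closedBall w₀ δ ⊆ cTimeTube n)
    {ψ : (Fin n → EuclideanSpace ℝ (Fin d)) → ℂ} (hψc : HasCompactSupport ψ) :
    ∃ M, ∀ w ∈ closedBall w₀ δ, ∀ y ∈ tsupport ψ, ‖𝔚 (tsCfg w y)‖ ≤ M := by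
  have hK : IsCompact (closedBall w₀ δ ×ˢ tsupport ψ) := (isCompact_closedBall _ _).prod hψc
  obtain ⟨M, hM⟩ := hK.exists_bound_of_continuousOn
    (hc.tsCfg.mono (prod_mono hsub (subset_univ _)))
  exact ⟨M, fun w hw y hy => hM (w, y) ⟨hw, hy⟩⟩

/-- **Spatial smearings of a continuous time-holomorphic function are holomorphic, with the
derivative under the integral sign**: for `ψ` continuous of compact support and `w₀ ∈ 𝒯ₙ`,
`w ↦ ∫ 𝔚 (tsCfg w y) ψ(y) dy` has at `w₀` the Fréchet derivative
`v ↦ ∫ ∂_v 𝔚 (w₀, y) ψ(y) dy`. [folklore] -/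
theorem hasFDerivAt_integral_tsCfg_mul (hc : ContinuousOn 𝔚 (timeTube d n))
    (hh : IsTimeHolomorphicOn 𝔚 (timeTube d n))
    {ψ : (Fin n → EuclideanSpace ℝ (Fin d)) → ℂ} (hψ : Continuous ψ) (hψc : HasCompactSupport ψ)
    {w₀ : Fin n → ℂ} (hw₀ : w₀ ∈ cTimeTube n) :
    ∃ L : (Fin n → ℂ) →L[ℂ] ℂ,
      (∀ v, L v = ∫ y, fderiv ℂ (fun w => 𝔚 (tsCfg w y)) w₀ v * ψ y) ∧
      HasFDerivAt (fun w => ∫ y, 𝔚 (tsCfg w y) * ψ y) L w₀ := by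
  obtain ⟨δ₀, hδ₀, hball⟩ := Metric.isOpen_iff.1 isOpen_cTimeTube w₀ hw₀
  set δ : ℝ := δ₀ / 2 with hδ
  have hδpos : 0 < δ := by positivity
  have hsub : closedBall w₀ δ ⊆ cTimeTube n := fun w hw =>
    hball (closedBall_subset_ball (by rw [hδ]; linarith) hw)
  obtain ⟨M, hM⟩ := exists_bound_tsCfg_closedBall hc hsub hψc
  have hWd : ∀ y, DifferentiableOn ℂ (fun w => 𝔚 (tsCfg w y)) (cTimeTube n) :=
    fun y => hh.differentiableOn_tsCfg y
  obtain ⟨L, hL, hLd⟩ :=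
    Literature.Analysis.Complex.hasFDerivAt_integral_of_dominated_of_differentiableOn
      (F := fun w y => 𝔚 (tsCfg w y) * ψ y) (μ := volume) hδpos
      (fun w hw => ((hc.tsCfg_space (hsub (ball_subset_closedBall hw))).mul hψ).aestronglyMeasurable)
      (Eventually.of_forall fun y =>
        ((hWd y).mono ((ball_subset_closedBall).trans hsub)).mul_const (ψ y))
      ((continuous_const.mul hψ.norm).integrable_of_hasCompactSupport hψc.norm.mul_left :
        Integrable (fun y => M * ‖ψ y‖) volume)
      (Eventually.of_forall fun y w hw => by
        by_cases hy : y ∈ tsupport ψ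
        · rw [norm_mul]
          exact mul_le_mul_of_nonneg_right (hM w (ball_subset_closedBall hw) y hy) (norm_nonneg _)
        · have h0 : ψ y = 0 := image_eq_zero_of_notMem_tsupport hy
          simp [h0])
  refine ⟨L, fun v => ?_, hLd⟩
  rw [hL v]
  congr 1
  funext y
  have hd : DifferentiableAt ℂ (fun w => 𝔚 (tsCfg w y)) w₀ :=
    (hWd y).differentiableAt (isOpen_cTimeTube.mem_nhds hw₀)
  rw [fderiv_mul_const hd, smul_apply, smul_eq_mul, mul_comm]

/-- Spatial smearings are holomorphic on `𝒯ₙ`. [folklore] -/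
theorem differentiableOn_integral_tsCfg_mul (hc : ContinuousOn 𝔚 (timeTube d n))
    (hh : IsTimeHolomorphicOn 𝔚 (timeTube d n))
    {ψ : (Fin n → EuclideanSpace ℝ (Fin d)) → ℂ} (hψ : Continuous ψ) (hψc : HasCompactSupport ψ) :
    DifferentiableOn ℂ (fun w => ∫ y, 𝔚 (tsCfg w y) * ψ y) (cTimeTube n) := fun _ hw =>
  (hasFDerivAt_integral_tsCfg_mul hc hh hψ hψc hw).choose_spec.2.differentiableAt
    |>.differentiableWithinAt

/-- **Differentiation of a spatial smearing under the integral sign**: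
`∂_v (∫ 𝔚 (tsCfg w y) ψ(y) dy) = ∫ ∂_v 𝔚 (w, y) ψ(y) dy` on `𝒯ₙ`. [folklore] -/
theorem fderiv_integral_tsCfg_mul (hc : ContinuousOn 𝔚 (timeTube d n))
    (hh : IsTimeHolomorphicOn 𝔚 (timeTube d n))
    {ψ : (Fin n → EuclideanSpace ℝ (Fin d)) → ℂ} (hψ : Continuous ψ) (hψc : HasCompactSupport ψ)
    {w : Fin n → ℂ} (hw : w ∈ cTimeTube n) (v : Fin n → ℂ) :
    fderiv ℂ (fun w => ∫ y, 𝔚 (tsCfg w y) * ψ y) w v =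
      ∫ y, fderiv ℂ (fun w => 𝔚 (tsCfg w y)) w v * ψ y := by
  obtain ⟨L, hL, hLd⟩ := hasFDerivAt_integral_tsCfg_mul hc hh hψ hψc hw
  rw [hLd.fderiv, hL v]

/-- The derivative of a spatial smearing along a real time shift:
`d/ds ∫ 𝔚 (tsCfg (w + s v) y) ψ(y) dy = ∫ ∂_v 𝔚 (w + s v, y) ψ(y) dy`. [folklore] -/
theorem hasDerivAt_integral_tsCfg_add_ofReal_smul (hc : ContinuousOn 𝔚 (timeTube d n))
    (hh : IsTimeHolomorphicOn 𝔚 (timeTube d n))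
    {ψ : (Fin n → EuclideanSpace ℝ (Fin d)) → ℂ} (hψ : Continuous ψ) (hψc : HasCompactSupport ψ)
    {w v : Fin n → ℂ} {s : ℝ} (hws : w + (s : ℂ) • v ∈ cTimeTube n) :
    HasDerivAt (fun s : ℝ => ∫ y, 𝔚 (tsCfg (w + (s : ℂ) • v) y) * ψ y)
      (∫ y, fderiv ℂ (fun w => 𝔚 (tsCfg w y)) (w + (s : ℂ) • v) v * ψ y) s := by
  have hd : DifferentiableAt ℂ (fun w => ∫ y, 𝔚 (tsCfg w y) * ψ y) (w + (s : ℂ) • v) :=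
    (differentiableOn_integral_tsCfg_mul hc hh hψ hψc).differentiableAt
      (isOpen_cTimeTube.mem_nhds hws)
  have h := (Literature.Analysis.Complex.SCV.hasDerivAt_slice hd).comp_ofReal
  rw [fderiv_integral_tsCfg_mul hc hh hψ hψc hws] at h
  exact h

end Literature.MathematicalPhysics.QuantumFieldTheory
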